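import Mathlib
import HarnessLib
import Summits.HubbardSuperconductivity.HubbardSuperconductivity.Theorems.KLProgrammeKLRegimeSplitTwoLegMomentsFromGrid
import Summits.HubbardSuperconductivity.HubbardSuperconductivity.Theorems.KLProgrammeKLRegimeEngineScaleZeroGridTransfer

/-!
# Route `KLProgramme` — ENGINE child 19918 (and its gen-6 successor), stub `stub_twoLeg_scale0`: the (E3d) FIELD STRENGTH of a grid image from the
# TEMPORAL first moment of the GRID two-leg kernel, and the scale-`0` representation `𝒱^{(0)} − 𝒩_K = map S_{4M} (W_{4M} − 𝒩_{K,4M})`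

Cell `gate-hubbard-kl`, seat p3 (g7).  Continues p1b's `…TwoLegMomentsFromGrid` (the log-free (M1) bridge from a GRID representation
`G = map (toLin' (gridSubMatrix L M β x τ)) W`: `kernel_two_map_gridSub`, `twoLeg_sep_momentumSizes_of_grid` under the representation
hypothesis `hW : 𝒱^{(n)} − 𝒩_K = map S W`) with the two pieces the momentum-keyed closers `twoLegCoreT_zero_of_momentumSizes[_stub5]`
(`…TwoLegCoreTMomentum`) still take from elsewhere at scale `0`:

* **(E3d) from the grid.**  The two leg phases of a pair `(p₀, p₁)` at `+ω₀` and `−ω₀` (`ω₀ = π/β`) differ by `2 sin((π/β)(τ_{p₀} − τ_{p₁}))`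
  (`norm_kernel_two_map_gridSub_omega0_sub_rev_le`, any point set); on the `N`-point time grid `τ_p = j_p β/N` this is at most
  `(2π/β)·(β/N)·circDist_N(j_{p₀}, j_{p₁})` (`two_abs_sin_gridTime_sub_le`), so
  `‖Σ_G(ω₀,k⃗,σ) − Σ_G(−ω₀,k⃗,σ)‖ ≤ (4πN/β²)·Bᵗ` and **`|z_G(k⃗) − 1| ≤ (2N/β)·Bᵗ`** whenever
  `Σ_{p₁} (β/N)·circDist_N(j_{p₀}, j_{p₁})·‖kernel W 2 ((p₀,σ,+),(p₁,σ,−))‖ ≤ Bᵗ` for every grid point `p₀` and both spins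
  (`norm_selfEnergy_omega0_sub_rev_map_gridSub_le_of_time_moment`, `abs_fieldStrengthSpin_/abs_fieldStrength_sub_one_map_gridSub_le_of_time_moment`)
  — the grid twin of `…FieldStrengthTimeMoment` (dual lattice, `ε_x = β/2M`), uniform in `M`; the constant `2N/β = 2|P|/(βL²)` is the one of
  p1b's coefficient bounds.  DIFFERENCE from p1b's `…TwoLegFieldStrengthFromGrid` (`abs_fieldStrength_map_gridSub_sub_one_le`, weight
  `|τ_{p₀} − τ_{p₁}|`, any `τ`): here the weight is the CIRCULAR grid distance `(β/N)·circDist_N(j₀, j₁)` (`|sin|` is `π`-periodic,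
  `abs_sin_pi_mul_sub_div_le_circDist`), i.e. exactly the time part of the W-chain's tree weight `gridLabelWt` (`cyclicDist`,
  `circDist_eq_cyclicDist` in `…EngineScaleZeroE4Geometry`) — a kernel on the imaginary-time circle decays in the circular distance, so only
  this form is fed by the decay-weighted determinant-bounded step.
* **The scale-`0` representation, discharged.**  `klEffectiveAction … K klE0 0 − counterQuadratic K = map (toLin' S_{4M}) (W_{4M} − 𝒩_{K,4M})`,
  `S_{4M} = gridSubMatrix L M β (·.2) (gridTime β 4M ·.1)` (`= hubbardGridSub`, `rfl`), `W_{4M} = effAction (S_{4M}ᵀ C^K_{>e₀} S_{4M}) (V_{4M} + 𝒩_{K,4M})`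
  (p3 g5's `klEffectiveAction_zero_eq_map_hubbardGridSub` and `map_hubbardGridSub_gridCounterQuadratic`), whence
  **`twoLeg_sep_momentumSizes_zero_of_grid`** = `twoLeg_sep_momentumSizes_of_grid` at `n = 0` with `hW` discharged (sizes from the pinned
  plain / off-diagonal weighted sums of `kernel₂ (W_{4M} − 𝒩_{K,4M})`), and **`abs_klFieldStrength_zero_sub_one_le_of_grid_time_moment`**
  (`|klFieldStrength … K 0 k⃗ − 1| ≤ (2·4M/β)·Bᵗ` from the time moment of `kernel₂ W_{4M}`; the counterterm's grid kernel is time-diagonal and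
  may be kept or dropped by the supplier).

Everything is PROVED; no definitions; nothing about the model is asserted.  References: BGM 2006 §2.1 (2.4)–(2.5), §2.3 (2.17)
[cite: BenfattoGiulianiMastropietro2006]; Salmhofer 1999 §4.2.4 (4.54)–(4.58) [cite: Salmhofer1999].
-/

noncomputable section

namespace Summit.HubbardSuperconductivity.HubbardSuperconductivity.Theorems.TwoLegFourier

set_option linter.dupNamespace false -- summit = problem name (single-conjunct summit), D-0017

open Finset Complex
open Literature.MathematicalPhysics.QuantumLattice Literature.Probability.LatticeModels GrassmannAlgebra
open Summit.HubbardSuperconductivity.HubbardSuperconductivity.Theorems.KLRegimeSplit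
open Summit.HubbardSuperconductivity.HubbardSuperconductivity.Theorems.KLProgrammeLegKernels

variable {L M : ℕ} [NeZero L] {P : Type*} [Fintype P] [DecidableEq P]

/-! ## §1 The `±ω₀` difference of the two-leg kernel of a grid image (any point set) -/

/-- **The `±ω₀` difference of the two-leg momentum kernel of `map S W`** (`S = gridSubMatrix β x τ`, `ω₀ = π/β`):
`‖F₊ − F₋‖ ≤ (βL²)⁻²·Σ_p 2|sin((π/β)(τ_{p₀} − τ_{p₁}))|·‖kernel W 2 ((p₀,σ,+),(p₁,σ,−))‖`. [cite: BenfattoGiulianiMastropietro2006, §2.1 (2.5)] -/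
theorem norm_kernel_two_map_gridSub_omega0_sub_rev_le [NeZero M] {β : ℝ} (hβ : 0 < β) (x : P → TorusSite 2 L) (τ : P → ℝ)
    (W : GrassmannAlgebra ℂ (GridLeg P)) (k : TorusSite 2 L) (σ : Fin 2) :
    ‖kernel ℂ (ExteriorAlgebra.map (Matrix.toLin' (gridSubMatrix L M β x τ)) W) 2
        (![(((omega0 M, k), σ), 0), (((omega0 M, k), σ), 1)] : Fin 2 → HubbardFieldIdx L M) -
      kernel ℂ (ExteriorAlgebra.map (Matrix.toLin' (gridSubMatrix L M β x τ)) W) 2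
        (![((((omega0 M).rev, k), σ), 0), ((((omega0 M).rev, k), σ), 1)] : Fin 2 → HubbardFieldIdx L M)‖ ≤
      (1 / (β * (L : ℝ) ^ 2)) ^ 2 *
        ∑ p : Fin 2 → P, 2 * |Real.sin (Real.pi / β * (τ (p 0) - τ (p 1)))| * ‖kernel ℂ W 2 (fun i => ((p i, σ), i))‖ := by
  rw [kernel_two_map_gridSub, kernel_two_map_gridSub, ← sum_sub_distrib, mul_sum]
  refine (norm_sum_le _ _).trans (sum_le_sum fun p _ => ?_)
  simp only []
  rw [matsubaraFreq_omega0, matsubaraFreq_omega0_rev, ← sub_mul, ← mul_sub, ← sub_mul, norm_mul, norm_mul, norm_mul, norm_pow,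
    Complex.norm_real, Real.norm_eq_abs, abs_of_nonneg (by positivity), norm_torusChar, mul_one]
  have hθ : ((-(Real.pi / β) * (τ (p 0) - τ (p 1)) : ℝ) : ℂ) * I = -((Real.pi / β * (τ (p 0) - τ (p 1)) : ℝ) : ℂ) * I := by
    push_cast
    ring
  rw [hθ, norm_cexp_mul_I_sub_cexp_neg_mul_I]
  exact le_of_eq (by ring)

/-! ## §2 On the `N`-point time grid: the sine against the grid circle distance -/

/-- **The grid time phase against the grid circle distance**: `2|sin((π/β)(τ_j − τ_{j′}))| ≤ (2π/β)·(β/N)·circDist_N(j, j′)`, `τ_j = jβ/N`. -/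
theorem two_abs_sin_gridTime_sub_le {N : ℕ} {β : ℝ} (hβ : 0 < β) (j j' : Fin N) :
    2 * |Real.sin (Real.pi / β * (gridTime β N j - gridTime β N j'))| ≤
      2 * (Real.pi / β) * (β / N * (circDist N j.val j'.val : ℝ)) := by
  have hN : 0 < N := j.pos
  have hNr : (0 : ℝ) < N := by exact_mod_cast hN
  have harg : Real.pi / β * (gridTime β N j - gridTime β N j') = Real.pi * ((j.val : ℝ) - j'.val) / N := by
    simp only [gridTime]
    field_simp
  rw [harg]
  have h := abs_sin_pi_mul_sub_div_le_circDist hN j.isLt j'.isLt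
  have hrhs : 2 * (Real.pi / β) * (β / N * (circDist N j.val j'.val : ℝ)) = 2 * (Real.pi * (circDist N j.val j'.val : ℝ) / N) := by
    field_simp
  rw [hrhs]
  linarith

variable {N : ℕ}

/-- **THE `±ω₀` DIFFERENCE OF THE SELF-ENERGY OF A GRID IMAGE FROM THE TEMPORAL FIRST MOMENT OF THE GRID KERNEL**: for the `N`-point time
grid (`S = gridSubMatrix β x (j ↦ jβ/N)`, any site map `x`), `β > 0`, momentum `k⃗`, spin `σ`: if
`Σ_{p₁} (β/N)·circDist_N(j_{p₀}, j_{p₁})·‖kernel W 2 ((p₀,σ,+),(p₁,σ,−))‖ ≤ Bᵗ` for every grid point `p₀`, then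
`‖Σ(ω₀,k⃗,σ) − Σ(−ω₀,k⃗,σ)‖ ≤ (4πN/β²)·Bᵗ`. [cite: BenfattoGiulianiMastropietro2006, §2.1 (2.4)–(2.5)] -/
theorem norm_selfEnergy_omega0_sub_rev_map_gridSub_le_of_time_moment [NeZero M] [NeZero N] {β : ℝ} (hβ : 0 < β)
    (x : GridPoint L N → TorusSite 2 L) (W : GrassmannAlgebra ℂ (GridLeg (GridPoint L N))) (k : TorusSite 2 L) (σ : Fin 2) {B : ℝ}
    (hB : ∀ p₀ : GridPoint L N, ∑ p₁ : GridPoint L N,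
      β / N * (circDist N p₀.1.val p₁.1.val : ℝ) * ‖kernel ℂ W 2 (fun i => ((![p₀, p₁] i, σ), i))‖ ≤ B) :
    ‖selfEnergy L M β (ExteriorAlgebra.map (Matrix.toLin' (gridSubMatrix L M β x (fun p => gridTime β N p.1))) W) (omega0 M, k) σ -
        selfEnergy L M β (ExteriorAlgebra.map (Matrix.toLin' (gridSubMatrix L M β x (fun p => gridTime β N p.1))) W)
          ((omega0 M).rev, k) σ‖ ≤
      4 * Real.pi * N / β ^ 2 * B := by
  set kW : (Fin 2 → GridPoint L N) → ℝ := fun p => ‖kernel ℂ W 2 (fun i => ((p i, σ), i))‖ with hkW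
  have hNr : (0 : ℝ) < N := by exact_mod_cast Nat.pos_of_ne_zero (NeZero.ne N)
  have hL : (0 : ℝ) < (L : ℝ) ^ 2 := by have := NeZero.ne L; positivity
  -- the pair sum against the pinned time-weighted sums
  have hpair : ∑ p : Fin 2 → GridPoint L N, 2 * |Real.sin (Real.pi / β * (gridTime β N (p 0).1 - gridTime β N (p 1).1))| * kW p ≤
      2 * (Real.pi / β) * ((Fintype.card (GridPoint L N) : ℝ) * B) := by
    calc ∑ p : Fin 2 → GridPoint L N, 2 * |Real.sin (Real.pi / β * (gridTime β N (p 0).1 - gridTime β N (p 1).1))| * kW p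
        ≤ ∑ p : Fin 2 → GridPoint L N, 2 * (Real.pi / β) * (β / N * (circDist N (p 0).1.val (p 1).1.val : ℝ) * kW p) :=
          sum_le_sum fun p _ => by
            have h := two_abs_sin_gridTime_sub_le hβ (p 0).1 (p 1).1
            have hk : 0 ≤ kW p := norm_nonneg _
            nlinarith
      _ = 2 * (Real.pi / β) * ∑ p₀ : GridPoint L N, ∑ p₁ : GridPoint L N,
            β / N * (circDist N p₀.1.val p₁.1.val : ℝ) * kW ![p₀, p₁] := by
          rw [← mul_sum, ← (piFinTwoEquiv fun _ => GridPoint L N).symm.sum_comp, Fintype.sum_prod_type]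
          rfl
      _ ≤ 2 * (Real.pi / β) * ∑ _p₀ : GridPoint L N, B := by
          gcongr with p₀
          have h := hB p₀
          simpa only [hkW] using h
      _ = 2 * (Real.pi / β) * ((Fintype.card (GridPoint L N) : ℝ) * B) := by rw [sum_const, card_univ, nsmul_eq_mul]
  have hcard : (Fintype.card (GridPoint L N) : ℝ) = N * (L : ℝ) ^ 2 := by
    rw [Fintype.card_prod, Fintype.card_fin, Fintype.card_pi, Fin.prod_const, ZMod.card]
    push_cast
    ring
  rw [selfEnergy_eq_vertexFn, selfEnergy_eq_vertexFn, ← mul_sub, norm_mul, Complex.norm_real, Real.norm_eq_abs,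
    abs_of_nonneg (by positivity)]
  have hker := norm_kernel_two_map_gridSub_omega0_sub_rev_le (M := M) hβ x (fun p : GridPoint L N => gridTime β N p.1) W k σ
  calc 2 * (β * (L : ℝ) ^ 2) * ‖kernel ℂ (ExteriorAlgebra.map (Matrix.toLin' (gridSubMatrix L M β x fun p => gridTime β N p.1)) W) 2
          ![(((omega0 M, k), σ), 0), (((omega0 M, k), σ), 1)] -
        kernel ℂ (ExteriorAlgebra.map (Matrix.toLin' (gridSubMatrix L M β x fun p => gridTime β N p.1)) W) 2
          ![((((omega0 M).rev, k), σ), 0), ((((omega0 M).rev, k), σ), 1)]‖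
      ≤ 2 * (β * (L : ℝ) ^ 2) * ((1 / (β * (L : ℝ) ^ 2)) ^ 2 * (2 * (Real.pi / β) * ((Fintype.card (GridPoint L N) : ℝ) * B))) := by
        refine mul_le_mul_of_nonneg_left (hker.trans ?_) (by positivity)
        exact mul_le_mul_of_nonneg_left hpair (by positivity)
    _ = 4 * Real.pi * N / β ^ 2 * B := by
        have hLne : (L : ℝ) ≠ 0 := by exact_mod_cast NeZero.ne L
        rw [hcard]
        field_simp
        ring

/-- **(E3d) for a grid image, per spin**: under the hypothesis of `norm_selfEnergy_omega0_sub_rev_map_gridSub_le_of_time_moment`,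
`|z(k⃗,σ) − 1| ≤ (2N/β)·Bᵗ` (`z = 1 − (Im Σ(ω₀) − Im Σ(−ω₀))/(2ω₀)`, `|Im a − Im b| ≤ ‖a − b‖`). -/
theorem abs_fieldStrengthSpin_sub_one_map_gridSub_le_of_time_moment [NeZero M] [NeZero N] {β : ℝ} (hβ : 0 < β)
    (x : GridPoint L N → TorusSite 2 L) (W : GrassmannAlgebra ℂ (GridLeg (GridPoint L N))) (k : TorusSite 2 L) (σ : Fin 2) {B : ℝ}
    (hB : ∀ p₀ : GridPoint L N, ∑ p₁ : GridPoint L N,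
      β / N * (circDist N p₀.1.val p₁.1.val : ℝ) * ‖kernel ℂ W 2 (fun i => ((![p₀, p₁] i, σ), i))‖ ≤ B) :
    |fieldStrengthSpin L M β (ExteriorAlgebra.map (Matrix.toLin' (gridSubMatrix L M β x (fun p => gridTime β N p.1))) W) k σ - 1| ≤
      2 * N / β * B := by
  set G := ExteriorAlgebra.map (Matrix.toLin' (gridSubMatrix L M β x (fun p => gridTime β N p.1))) W with hG
  have h := norm_selfEnergy_omega0_sub_rev_map_gridSub_le_of_time_moment (M := M) hβ x W k σ hB
  have hω : 0 < 2 * (Real.pi / β) := by positivity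
  rw [fieldStrengthSpin, sub_sub_cancel_left, abs_neg, abs_div, abs_of_pos hω, div_le_iff₀ hω]
  have him : |(selfEnergy L M β G (omega0 M, k) σ).im - (selfEnergy L M β G ((omega0 M).rev, k) σ).im| ≤
      ‖selfEnergy L M β G (omega0 M, k) σ - selfEnergy L M β G ((omega0 M).rev, k) σ‖ := by
    rw [← Complex.sub_im]
    exact Complex.abs_im_le_norm _
  calc _ ≤ ‖selfEnergy L M β G (omega0 M, k) σ - selfEnergy L M β G ((omega0 M).rev, k) σ‖ := him
    _ ≤ 4 * Real.pi * N / β ^ 2 * B := h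
    _ = 2 * N / β * B * (2 * (Real.pi / β)) := by
        field_simp
        ring

/-- **(E3d) for a grid image, spin-averaged**: with the grid time-moment bound for both spin strings, `|z(k⃗) − 1| ≤ (2N/β)·Bᵗ`. -/
theorem abs_fieldStrength_sub_one_map_gridSub_le_of_time_moment [NeZero M] [NeZero N] {β : ℝ} (hβ : 0 < β)
    (x : GridPoint L N → TorusSite 2 L) (W : GrassmannAlgebra ℂ (GridLeg (GridPoint L N))) (k : TorusSite 2 L) {B : ℝ}
    (hB : ∀ (σ : Fin 2) (p₀ : GridPoint L N), ∑ p₁ : GridPoint L N,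
      β / N * (circDist N p₀.1.val p₁.1.val : ℝ) * ‖kernel ℂ W 2 (fun i => ((![p₀, p₁] i, σ), i))‖ ≤ B) :
    |fieldStrength L M β (ExteriorAlgebra.map (Matrix.toLin' (gridSubMatrix L M β x (fun p => gridTime β N p.1))) W) k - 1| ≤
      2 * N / β * B := by
  set G := ExteriorAlgebra.map (Matrix.toLin' (gridSubMatrix L M β x (fun p => gridTime β N p.1))) W with hG
  have h0 := abs_fieldStrengthSpin_sub_one_map_gridSub_le_of_time_moment (M := M) hβ x W k 0 (hB 0)
  have h1 := abs_fieldStrengthSpin_sub_one_map_gridSub_le_of_time_moment (M := M) hβ x W k 1 (hB 1)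
  rw [fieldStrength]
  have : (fieldStrengthSpin L M β G k 0 + fieldStrengthSpin L M β G k 1) / 2 - 1 =
      ((fieldStrengthSpin L M β G k 0 - 1) + (fieldStrengthSpin L M β G k 1 - 1)) / 2 := by ring
  rw [this, abs_div, abs_two]
  have htri := abs_add_le (fieldStrengthSpin L M β G k 0 - 1) (fieldStrengthSpin L M β G k 1 - 1)
  linarith

/-! ## §3 The cell at scale `0`: the representation discharged, the (E3a) momentum-side sizes and the (E3d) field strength from the grid -/

section Model

open Summit.HubbardSuperconductivity.HubbardSuperconductivity.Theorems.EngineV8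

variable [NeZero M]

/-- **`𝒱^{(0)} − 𝒩_K` IS the grid image of the grid effective action minus the grid counterterm** (`N = 4M`; the representation hypothesis
`hW` of `twoLeg_sep_momentumSizes_of_grid` at `n = 0`, DISCHARGED):
`klEffectiveAction … K klE0 0 − counterQuadratic K = map (toLin' (gridSubMatrix β (·.2) (gridTime β 4M ·.1))) (W_{4M} − 𝒩_{K,4M})`,
`W_{4M} = effAction (S_{4M}ᵀ C^K_{>e₀} S_{4M}) (V_{4M} + 𝒩_{K,4M})` (`hubbardGridSub = gridSubMatrix …` by `rfl`; p3 g5's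
`klEffectiveAction_zero_eq_map_hubbardGridSub`, `map_hubbardGridSub_gridCounterQuadratic` with `2M ≤ 4M`). -/
theorem klEffectiveAction_zero_sub_counterQuadratic_eq_map_gridSub {β : ℝ} (hβ : β ≠ 0) (U μ : ℝ) (K : TrigPolyC4v) :
    klEffectiveAction L M β U μ K klE0 0 - counterQuadratic L M β K =
      ExteriorAlgebra.map (Matrix.toLin' (gridSubMatrix L M β (fun p : GridPoint L (2 * (2 * M)) => p.2)
          (fun p => gridTime β (2 * (2 * M)) p.1)))
        (effAction ℂ ((hubbardGridSub L M β (2 * (2 * M))).transpose * hubbardCovAboveCT L M β μ 0 K klE0 *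
            hubbardGridSub L M β (2 * (2 * M)))
          (hubbardGridInteraction L (2 * (2 * M)) β U + hubbardGridCounterQuadratic L (2 * (2 * M)) β K) -
          hubbardGridCounterQuadratic L (2 * (2 * M)) β K) := by
  haveI : NeZero (2 * (2 * M) : ℕ) := ⟨by have := NeZero.ne M; omega⟩
  rw [map_sub, show gridSubMatrix L M β (fun p : GridPoint L (2 * (2 * M)) => p.2) (fun p => gridTime β (2 * (2 * M)) p.1) =
      hubbardGridSub L M β (2 * (2 * M)) from rfl, klEffectiveAction_zero_eq_map_hubbardGridSub hβ U μ K klE0,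
    map_hubbardGridSub_gridCounterQuadratic (L := L) (M := M) (N := 2 * (2 * M)) hβ K (by omega)]

/-- **THE ENGINE'S SCALE-0 (E3a) MOMENTUM-SIDE SIZES FROM THE GRID, representation discharged**: with
`W' := W_{4M} − 𝒩_{K,4M}`, if for both spins and every grid point `p₀` `Σ_{p₁} ‖kernel W' 2 ((p₀,σ,+),(p₁,σ,−))‖ ≤ B 0` and the OFF-DIAGONAL
weighted sums `Σ_{p₁} [x⃗_{p₁} ≠ x⃗_{p₀}](1+|Δx̃₀|+|Δx̃₁|)ᵏ‖kernel W' 2 (…)‖ ≤ B k` (`k = 1, 2`), then for `k ≤ 2`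
`‖Dᵏ evalM (symInterp L (klLocSelfEnergyRe … K 0 − K∘p)) q‖ ≤ (2·|GridPoint L 4M|/(|β|L²))·B k` — the input `hm` of
`twoLegCoreT_zero_of_momentumSizes[_stub5]`, uniform in `M` (`|GridPoint L 4M|/L² = 4M`, and `B k = O(β/4M)` for the grid kernels). -/
theorem twoLeg_sep_momentumSizes_zero_of_grid {β : ℝ} (hβ : β ≠ 0) (U μ : ℝ) (K : TrigPolyC4v) {B : ℕ → ℝ}
    (hB0 : ∀ (σ : Fin 2) (p₀ : GridPoint L (2 * (2 * M))), ∑ p₁ : GridPoint L (2 * (2 * M)),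
      ‖kernel ℂ
        (effAction ℂ ((hubbardGridSub L M β (2 * (2 * M))).transpose * hubbardCovAboveCT L M β μ 0 K klE0 *
            hubbardGridSub L M β (2 * (2 * M)))
          (hubbardGridInteraction L (2 * (2 * M)) β U + hubbardGridCounterQuadratic L (2 * (2 * M)) β K) -
          hubbardGridCounterQuadratic L (2 * (2 * M)) β K) 2 (fun i => ((![p₀, p₁] i, σ), i))‖ ≤ B 0)
    (hBk : ∀ k, 1 ≤ k → k ≤ 2 → ∀ (σ : Fin 2) (p₀ : GridPoint L (2 * (2 * M))), ∑ p₁ : GridPoint L (2 * (2 * M)),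
      (if p₁.2 - p₀.2 = 0 then (0 : ℝ) else
        (1 + (((p₁.2 - p₀.2) 0).valMinAbs.natAbs : ℝ) + (((p₁.2 - p₀.2) 1).valMinAbs.natAbs : ℝ)) ^ k) *
        ‖kernel ℂ
          (effAction ℂ ((hubbardGridSub L M β (2 * (2 * M))).transpose * hubbardCovAboveCT L M β μ 0 K klE0 *
              hubbardGridSub L M β (2 * (2 * M)))
            (hubbardGridInteraction L (2 * (2 * M)) β U + hubbardGridCounterQuadratic L (2 * (2 * M)) β K) -
            hubbardGridCounterQuadratic L (2 * (2 * M)) β K) 2 (fun i => ((![p₀, p₁] i, σ), i))‖ ≤ B k) :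
    ∀ k ≤ 2, ∀ q : Momentum, ‖iteratedFDeriv ℝ k
      (evalM (symInterp L (fun p => klLocSelfEnergyRe L M β U μ K 0 p - K.eval (latticeMomentum L p)))) q‖ ≤
        2 * (Fintype.card (GridPoint L (2 * (2 * M))) : ℝ) / (|β| * (L : ℝ) ^ 2) * B k :=
  twoLeg_sep_momentumSizes_of_grid hβ U μ K 0 (fun p : GridPoint L (2 * (2 * M)) => p.2) (fun p => gridTime β (2 * (2 * M)) p.1) _
    (klEffectiveAction_zero_sub_counterQuadratic_eq_map_gridSub hβ U μ K) hB0 hBk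

/-- **THE ENGINE'S SCALE-0 (E3d) EXPORT FROM THE GRID**: if the temporal first moment of the grid two-leg kernel of the scale-`0` grid effective
action `W_{4M}` satisfies, for both spins and every grid point `p₀`, `Σ_{p₁} (β/4M)·circDist_{4M}(j_{p₀}, j_{p₁})·‖kernel W_{4M} 2 ((p₀,σ,+),(p₁,σ,−))‖ ≤ Bᵗ`,
then `|klFieldStrength … K 0 k⃗ − 1| ≤ (2·4M/β)·Bᵗ` at every torus momentum — the field-strength hypothesis of `twoLegCoreT_zero_of_momentumSizes`
on the shell, uniform in `M`. -/
theorem abs_klFieldStrength_zero_sub_one_le_of_grid_time_moment {β : ℝ} (hβ : 0 < β) (U μ : ℝ) (K : TrigPolyC4v)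
    (k : TorusSite 2 L) {B : ℝ}
    (hB : ∀ (σ : Fin 2) (p₀ : GridPoint L (2 * (2 * M))), ∑ p₁ : GridPoint L (2 * (2 * M)),
      β / ((2 * (2 * M) : ℕ) : ℝ) * (circDist (2 * (2 * M)) p₀.1.val p₁.1.val : ℝ) *
        ‖kernel ℂ
          (effAction ℂ ((hubbardGridSub L M β (2 * (2 * M))).transpose * hubbardCovAboveCT L M β μ 0 K klE0 *
              hubbardGridSub L M β (2 * (2 * M)))
            (hubbardGridInteraction L (2 * (2 * M)) β U + hubbardGridCounterQuadratic L (2 * (2 * M)) β K)) 2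
          (fun i => ((![p₀, p₁] i, σ), i))‖ ≤ B) :
    |klFieldStrength L M β U μ K 0 k - 1| ≤ 2 * ((2 * (2 * M) : ℕ) : ℝ) / β * B := by
  haveI : NeZero (2 * (2 * M) : ℕ) := ⟨by have := NeZero.ne M; omega⟩
  rw [klFieldStrength, klEffectiveAction_zero_eq_map_hubbardGridSub hβ.ne' U μ K klE0,
    show hubbardGridSub L M β (2 * (2 * M)) =
      gridSubMatrix L M β (fun p : GridPoint L (2 * (2 * M)) => p.2) (fun p => gridTime β (2 * (2 * M)) p.1) from rfl]
  exact abs_fieldStrength_sub_one_map_gridSub_le_of_time_moment hβ _ _ k hB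

end Model

end Summit.HubbardSuperconductivity.HubbardSuperconductivity.Theorems.TwoLegFourier

end
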